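import Mathlib
import HarnessLib
import HarnessLib.Audit
import Summits.QuantumAdvantage.AdviceFreeQNC0.PredHard
import Summits.QuantumAdvantage.AdviceFreeQNC0.DWalkOneBell

/-!
# NamingDial, part A/4 (§1: rung E1 — the exclusion two-thirds law, PROVED, and its sharpness) — support for item stmt-QuantumAdvantage-22907 (`Theses.DWalkThree.RingDenseResidualLt3`)

Cell decomp-qadv, seat lens-1 («grading / quantitative ladder»), generation 17 — land port of the node «NamingDial» (published under the cell's HOME/decomp-qadv-lens-1/g17/NamingDial.lean, record NODE-g17.md; RESIDUAL MODE on DWalkThree:22907). The node file with ONLY the namespace renamed `Theses.NamingDial → Theorems.NamingDial` and split at section boundaries into parts A–D (A, B, C independent; part D imports part A and alone imports the route file Theses.DWalkThree for the BY-NAME `closes`).  Prop-defs = the node's hardness predicate `ExclusionTwoThirds3` (part A, PROVED there), the counting functions `listing`/`wins` and explicit strategies (parts B, C), and the declared residual `NamingLift3` (part D).  Tree facts reused by name, not restated: `DWalk.predHardDWB3`, `two_pow_le_card_odd_class`, `card_odd_filter_le`, `three_mul_card_affine_mod_three`, `stake_eq_affine`, `dk3_eq_one_iff`, `Coset21.oddOneOutForm_holds`,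 `wtPrefix_zero`, `ConstBells.wtPrefix_self`, `Coset21.wtPrefix_succ`, `RigidityLaws.wtPrefix_one`, `Theorems.dWalkThree_ringFixedBellsSharp3`, `Theorems.dWalkThree_ringBShot3`.  No `sorry`, no new axioms, no instances, no notation.

THIS PART: `ExclusionTwoThirds3`, `zmod3_ne_iff`, `exclusionTwoThirds3`, `three_mul_card_dk3_eq_one_le`, `exclusion_sharp`, `one_mem_lowDeg_zero`.

NODE SYNOPSIS (all parts):

# NamingDial — lens-1 (grading / quantitative ladder) node, cell `decomp-qadv`, generation 17

TARGET (blocker, by name): `Theses.DWalkThree.RingDenseResidualLt3` (stmt-QuantumAdvantage-22907)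
`= RingFixedBellsSharp3 → RingBShot3 → RingHardOdd 3`, both hypotheses PROVED in the tree, so the item is
`RingHardOdd 3` (T): Bob's polylog-degree `𝔽₃` strategies win the mod-3 ring game on at most `θ·2^{n-1}` odd inputs.

THE DIAL.  Grade a strategy by HOW MUCH IT MUST NAME.  By the tree's odd-one-out form T′
(`Coset21.oddOneOutForm_holds`) every strategy `y` wins on `u` iff `nae₀ y u ∧ wt u ≢ −c − oddOneOut y u (mod 3)`:
winning IS excluding one value of the secret `W = |u| mod 3`, the excluded value being named by the REFEREE-assisted
colouring `u ↦ −c − oddOneOut y u` (computed from the hidden class parities).  The rungs, weakest player first: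

* E1 DEFINABLE NAMING  — the player himself outputs a polylog-degree `𝔽₃`-colouring `g` and wins iff `g x ≠ D_k x`.
* E2 ONE BLIND BET      — one bell at a fixed cut, rung adaptively (`OneBellDWB3`, PROVED in tree).
* E3 FEW BLIND BETS     — `≤ N^{1/4}` ringing bells (`BShotDWB3`, PROVED in tree).
* E4 MANY BLIND BETS    — all polylog strategies = T.

LAWS PROVED IN THIS FILE (0 sorry):

* L1 `exclusionTwoThirds3` (rung E1, NEW): no polylog `𝔽₃`-colouring EXCLUDES the stake `D_k` on more than
  `(2/3+ε)` of the odd class — from the tree's prediction law `DWalk.predHardDWB3` by the shift pigeonhole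
  `{g ≠ D} = {g+1 = D} ⊔ {g+2 = D}`.  SHARP: `exclusion_sharp` — the constant colouring `1` (degree 0) excludes `D_k` on
  `≥ (2^N − 2)/3` odd inputs (`three_mul_card_dk3_eq_one_le`, the upper twin of the tree's odd-class equidistribution).
* L2 `exchangeLaw`: for EVERY strategy, `#wins_c(y) = Λ₁ + Λ₂`, `Λ_j = #{u : nae₀ ∧ wt u + c + oddOneOut ≡ j}` —
  wins and correct "listings" of `W` are the same currency at rate ≤ 2 (`listing_le_wins`, `wins_le_two_max`).
* L3 `endpointPair_concentrated` (+ `endpointPair_win_iff`): the degree-0 strategy firing cuts `0` and `n` puts ALL its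
  wins on ONE residue (`wt u + c + oddOneOut ≡ c + 2n`) and wins iff `c ≢ n ∧ n + W ≢ 0` (≈ 2/3 of inputs): the listing
  rate `max_j Λ_j / 2ⁿ` already reaches `2/3` at degree 0, so NO listing threshold `π < 2/3` holds and the factor-2
  exchange cannot carry a bound below `T` — the «ListingDial» door is CLOSED (instrument `g17/exp/listing.py`, n ≤ 8:
  exchange-law violations 0; max listing 0.664 at Y = {0,n}; max win 0.75, 0.6875, 0.672 for n = 3‥8).
* L4 `promise_one` / `promise_two_wins`: give the player ONE value that `W` is NOT and the game collapses — on a promise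
  class `{W ≡ r}` a constant single cut wins EVERY input (degree 0), and on `{W ≢ r₀}` the strategy «first cut of prefix
  class `−c−r₀` among the first `K`» wins every input whose class walk hits that class before `K` (all but a `2^{1-K}`
  fraction: `avoid_forces_prefix`).  The hardness of T is exactly the LAST trit: input partitions by the hidden class
  (σ-promise / monodromy classes, `g17/exp/fullclass.py`: the identity-monodromy FULL class is won by `tGuess` w.p. 1.000,
  N = 4‥10) are classically trivial — the «PromiseDial» door is CLOSED.

NODE EQUATION (honest LADDER; no route requested):
  `RingDenseResidualLt3 ⟸ ExclusionTwoThirds3 [E1 · WEAKER · PROVED here] ∧ NamingLift3 [E1 → RingHardOdd 3 · ≡ T given E1 ·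
  IDEA-NEEDED: a two-moduli correlation bound for MANY blind bets]` — `closes` below, by name.  The residual is the blocker
  itself; what this generation adds is the proved rung BELOW the one-bell law and two door-closing laws (L3, L4) with
  kernel witnesses, so that later lens-1 seats do not re-open the listing-threshold or promise-class dials.

WHY EACH PIECE IS STRICTLY WEAKER / EQUIVALENT.  E1 is a theorem (this file) while T is open (probe P1 `E1 → T` fails);
informally E1 sits below E3 (a named exclusion `W ≠ E(u)` turns into a ≤ 1-ringing-bell strategy — the u-coordinate construction
is `promise_two_wins` with `r₀ :=` the named value); `NamingLift3` is T itself given E1 (declared, not hidden: `lift_of_target`).  WHY NOVEL relative to the other five lenses: no other node grades by the information the player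
must NAME (exclusion vs blind bet), none has the exchange identity `wins = Λ₁ + Λ₂` or the promise-collapse law; lens-2
(BlindLoss/pointer readers), lens-3 (Quartic/Perceptron), lens-4 (Unity/Live), lens-5 (Grade/Corner/Restriction), lens-6
(Null/Slice/Orbit) grade strategies or inputs by algebraic shape, not by naming power.

REPAIR CENSUS (doors tried this generation and why each is closed — evidence in `g17/NODE-g17.md`): degree / depth / prime
gradings (nested ⇒ LADDER, g14–g16); locality by partition (win-neutral scrambling, g15 law) and by domination
(`ringLocal_polylog_lt3` already PROVES the polylog-radius local law ⇒ residual ≡ T); listing threshold (L3 above);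
law-shape dial on `wt u + oddOneOut` (a sure value ≠ −c IS near-perfect play ≡ ¬T); promise / monodromy classes (L4);
density-hurts (false: win-neutral gated triples); charge split (three-charge identity ⇒ similar subcases); XOR / direct
product (returns to the untyped (D3-core′)); (degree, sparsity) bi-grading (next rungs are items 27655 / PerfectDial).
-/

namespace Summit.QuantumAdvantage.QuantumAdvantage.Theorems.NamingDial

set_option linter.dupNamespace false

open Classical
open Finset
open Summit.QuantumAdvantage.AdviceFreeQNC0
open Literature.Computability.MetaComplexity Literature.Computability.MetaComplexity.Smolensky

/-! ## §1  Rung E1 — definable naming: the exclusion two-thirds law (PROVED) -/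

/-- **E1 `ExclusionTwoThirds3`** (WEAKER than T; PROVED below).  For every cut `k` and every `𝔽₃`-polynomial colouring `g`
of degree `≤ (log₂ N)^C`, the odd-class inputs on which `g` EXCLUDES the stake, `g x ≠ D_k x`, number at most
`(2/3 + ε)·2^{N-1}`, i.e. `3·#{x odd : g x ≠ D_k x} ≤ 2^N + ε 2^N`.  Test of weakness: it is a theorem (from
`DWalk.predHardDWB3`), T is open. -/
def ExclusionTwoThirds3 : Prop :=
  ∀ ε : ℝ, 0 < ε → ∀ C : ℕ, ∃ n₀ : ℕ, ∀ N ≥ n₀, ∀ k : Fin N,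
    ∀ g : Smolensky.CubeFn (ZMod 3) N, g ∈ Smolensky.lowDeg (ZMod 3) N ((Nat.log 2 N) ^ C) →
      (3 * ((univ.filter fun x : Fin N → Bool =>
          (univ.filter fun b : Fin N => x b = false).card % 2 = 1 ∧ g x ≠ Dk3 x k.val).card : ℝ)
        ≤ (2 : ℝ) ^ N + ε * (2 : ℝ) ^ N)

/-- the shift pigeonhole in `𝔽₃`: `a ≠ b ↔ a + 1 = b ∨ a + 1 + 1 = b`. -/
theorem zmod3_ne_iff (a b : ZMod 3) : a ≠ b ↔ (a + 1 = b ∨ a + 1 + 1 = b) := by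
  revert a b; decide

/-- **L1 — rung E1 is a THEOREM**: exclusion ≤ 2/3 + ε, from the tree's prediction law `predHardDWB3` applied to the two
shifted colourings `g + 1`, `g + 2`. -/
theorem exclusionTwoThirds3 : ExclusionTwoThirds3 := by
  intro ε hε C
  obtain ⟨n₀, hn₀⟩ := DWalk.predHardDWB3 (ε / 2) (by positivity) C
  refine ⟨max n₀ 1, fun N hN k g hg => ?_⟩
  have hN₀ : n₀ ≤ N := le_trans (le_max_left _ _) hN
  have hN1 : 1 ≤ N := le_trans (le_max_right _ _) hN
  have hg1 : g + 1 ∈ Smolensky.lowDeg (ZMod 3) N ((Nat.log 2 N) ^ C) :=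
    Submodule.add_mem _ hg (one_mem_lowDeg _)
  have hg2 : g + 1 + 1 ∈ Smolensky.lowDeg (ZMod 3) N ((Nat.log 2 N) ^ C) :=
    Submodule.add_mem _ hg1 (one_mem_lowDeg _)
  have h1 := hn₀ N hN₀ k (g + 1) hg1
  have h2 := hn₀ N hN₀ k (g + 1 + 1) hg2
  set A := univ.filter fun x : Fin N → Bool =>
      (univ.filter fun b : Fin N => x b = false).card % 2 = 1 ∧ g x ≠ Dk3 x k.val with hA
  set B₁ := univ.filter fun x : Fin N → Bool =>
      (univ.filter fun b : Fin N => x b = false).card % 2 = 1 ∧ (g + 1) x = Dk3 x k.val with hB₁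
  set B₂ := univ.filter fun x : Fin N → Bool =>
      (univ.filter fun b : Fin N => x b = false).card % 2 = 1 ∧ (g + 1 + 1) x = Dk3 x k.val with hB₂
  have hsub : A ⊆ B₁ ∪ B₂ := by
    intro x hx
    simp only [hA, hB₁, hB₂, mem_filter, mem_union, mem_univ, true_and, Pi.add_apply, Pi.one_apply] at hx ⊢
    rcases hx with ⟨ho, hne⟩
    rcases (zmod3_ne_iff (g x) (Dk3 x k.val)).1 hne with h | h
    · exact Or.inl ⟨ho, h⟩
    · exact Or.inr ⟨ho, h⟩
  have hcard : A.card ≤ B₁.card + B₂.card := le_trans (card_le_card hsub) (card_union_le _ _)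
  have hcardR : (A.card : ℝ) ≤ (B₁.card : ℝ) + (B₂.card : ℝ) := by exact_mod_cast hcard
  have hpow : (2 : ℝ) ^ N = 2 * (2 : ℝ) ^ (N - 1) := by
    obtain ⟨M, rfl⟩ : ∃ M, N = M + 1 := ⟨N - 1, by omega⟩
    simp [pow_succ, mul_comm]
  nlinarith [h1, h2, hcardR, hpow]

/-! ### E1 is SHARP: a constant colouring already excludes the stake on `2/3 − o(1)` of the odd class -/

/-- upper half of the odd-class equidistribution of the stake: `3·#{x odd : Dk3 x k = 1} ≤ 2ⁿ + 2` (`N = n+1 ≥ 3`), the twin of the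
tree's `two_pow_le_three_mul_card_dk3_eq_one` (same chart transfer, upper inequality of `three_mul_card_affine_mod_three`). -/
theorem three_mul_card_dk3_eq_one_le {n : ℕ} (hn : 2 ≤ n) (k : Fin (n + 1)) :
    3 * ((univ.filter fun x : Fin (n + 1) → Bool =>
      (univ.filter fun j : Fin (n + 1) => x j = false).card % 2 = 1 ∧ Dk3 x k.val = 1).card : ℤ) ≤ (2 : ℤ) ^ n + 2 := by
  have hk : k.val ≤ n := by have := k.isLt; omega
  obtain ⟨κ, hκ⟩ : ∃ κ : Fin n → ℕ, κ = fun i => if i.val < k.val then 2 else 1 := ⟨_, rfl⟩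
  have hκ0 : ∀ i, κ i % 3 ≠ 0 := by intro i; rw [hκ]; dsimp only; split_ifs <;> decide
  obtain ⟨Q, hQ⟩ : ∃ Q : (Fin n → Bool) → Prop, Q = fun u =>
    ((k.val + n + 1) + ∑ i : Fin n, (if u i = true then κ i else 0)) % 3 = 2 % 3 := ⟨_, rfl⟩
  have hset : (univ.filter fun x : Fin (n + 1) → Bool =>
      (univ.filter fun j : Fin (n + 1) => x j = false).card % 2 = 1 ∧ Dk3 x k.val = 1).card =
      (univ.filter fun x : Fin (n + 1) → Bool =>
        (univ.filter fun j : Fin (n + 1) => x j = false).card % 2 = 1 ∧ Q (uVec x)).card := by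
    congr 1
    ext x
    simp only [mem_filter, mem_univ, true_and, hQ, dk3_eq_one_iff, stake_eq_affine x hk, hκ]
  rw [hset]
  have hle := card_odd_filter_le hn Q
  have hQcount := (three_mul_card_affine_mod_three n κ hκ0 (k.val + n + 1) 2).2
  unfold affCount at hQcount
  have hQcard : (univ.filter fun u : Fin n → Bool => Q u).card =
      (univ.filter fun u : Fin n → Bool =>
        ((k.val + n + 1) + ∑ i : Fin n, (if u i = true then κ i else 0)) % 3 = 2 % 3).card := by
    congr 1; ext u; simp only [mem_filter, mem_univ, true_and, hQ]
  rw [hQcard] at hle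
  have hlez : ((univ.filter fun x : Fin (n + 1) → Bool =>
        (univ.filter fun j : Fin (n + 1) => x j = false).card % 2 = 1 ∧ Q (uVec x)).card : ℤ) ≤
      ((univ.filter fun u : Fin n → Bool =>
        ((k.val + n + 1) + ∑ i : Fin n, (if u i = true then κ i else 0)) % 3 = 2 % 3).card : ℤ) := by
    exact_mod_cast hle
  linarith

/-- **L1♯ — E1 is SHARP**: the constant colouring `1` (degree 0) excludes the stake `D_k` on at least `(2/3)·2ⁿ − 2/3` odd inputs:
`2^N − 2 ≤ 3·#{x odd : 1 ≠ Dk3 x k}` for `N = n + 1 ≥ 3`.  So the value of the definable-naming game is exactly `2/3 + o(1)`. -/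
theorem exclusion_sharp {n : ℕ} (hn : 2 ≤ n) (k : Fin (n + 1)) :
    (2 : ℤ) ^ (n + 1) - 2 ≤ 3 * ((univ.filter fun x : Fin (n + 1) → Bool =>
      (univ.filter fun j : Fin (n + 1) => x j = false).card % 2 = 1 ∧
        (1 : Smolensky.CubeFn (ZMod 3) (n + 1)) x ≠ Dk3 x k.val).card : ℤ) := by
  have hup := three_mul_card_dk3_eq_one_le hn k
  have hodd := two_pow_le_card_odd_class (n := n)
  -- the odd class splits into `{D = 1}` and `{1 ≠ D}`
  have hsplit := Finset.card_filter_add_card_filter_not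
    (s := univ.filter fun x : Fin (n + 1) → Bool => (univ.filter fun j : Fin (n + 1) => x j = false).card % 2 = 1)
    (fun x => Dk3 x k.val = 1)
  rw [Finset.filter_filter, Finset.filter_filter] at hsplit
  have hne : (univ.filter fun x : Fin (n + 1) → Bool =>
      (univ.filter fun j : Fin (n + 1) => x j = false).card % 2 = 1 ∧ ¬ Dk3 x k.val = 1).card =
      (univ.filter fun x : Fin (n + 1) → Bool =>
      (univ.filter fun j : Fin (n + 1) => x j = false).card % 2 = 1 ∧
        (1 : Smolensky.CubeFn (ZMod 3) (n + 1)) x ≠ Dk3 x k.val).card := by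
    congr 1; ext x
    simp only [mem_filter, mem_univ, true_and, Pi.one_apply, ne_comm (a := (1 : ZMod 3)), ne_eq]
  rw [hne] at hsplit
  have hsplitz : ((univ.filter fun x : Fin (n + 1) → Bool =>
      (univ.filter fun j : Fin (n + 1) => x j = false).card % 2 = 1 ∧ Dk3 x k.val = 1).card : ℤ) +
      ((univ.filter fun x : Fin (n + 1) → Bool =>
      (univ.filter fun j : Fin (n + 1) => x j = false).card % 2 = 1 ∧
        (1 : Smolensky.CubeFn (ZMod 3) (n + 1)) x ≠ Dk3 x k.val).card : ℤ) =
      ((univ.filter fun x : Fin (n + 1) → Bool =>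
        (univ.filter fun j : Fin (n + 1) => x j = false).card % 2 = 1).card : ℤ) := by
    exact_mod_cast hsplit
  have hoddz : (2 : ℤ) ^ n ≤ ((univ.filter fun x : Fin (n + 1) → Bool =>
        (univ.filter fun j : Fin (n + 1) => x j = false).card % 2 = 1).card : ℤ) := by
    exact_mod_cast hodd
  have hpow : (2 : ℤ) ^ (n + 1) = 2 * 2 ^ n := by ring
  linarith

/-- the constant colouring is of degree `0` (so it is admissible in `ExclusionTwoThirds3` for every `C`). -/
theorem one_mem_lowDeg_zero (N : ℕ) : (1 : Smolensky.CubeFn (ZMod 3) N) ∈ Smolensky.lowDeg (ZMod 3) N 0 :=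
  one_mem_lowDeg 0

end Summit.QuantumAdvantage.QuantumAdvantage.Theorems.NamingDial
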